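import Literature.NumberTheory.Sieve.FriedlanderIwaniecPrimesJacobiTwistedLemma114
import Literature.NumberTheory.Sieve.LargeSieveCharacters
import HarnessLib

/-!
# Friedlander–Iwaniec, *The polynomial `X² + Y⁴` captures its primes*, §11: the forms `V(D)`, `W(D)` and the arithmetic of the proof of Proposition 11.1

Family `parity`, statement parity.S17 (`setOf_prime_sq_add_pow_four_infinite`). Source: J. Friedlander,
H. Iwaniec, Ann. of Math. (2) 148 (1998), 945–1040 [FriedlanderIwaniecAnnals1998], §11, (11.5)–(11.11),
(11.18)–(11.20).

Fourth file of the §§11–14 unit ("Jacobi-twisted sums over arithmetic progressions"). It fixes the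
objects of Proposition 11.1 and proves the arithmetic (non-analytic) ingredients of its proof;
everything is PROVED, and the only definitions are the forms themselves and two pieces of notation:

* `jtChar d r = (r / d')` (Jacobi symbol to the odd part `d'`), `congrSol m r s` = the class
  `s r̄ (mod m)` as a natural number `< m` (`dvd_sub_congrSol_mul`, `dvd_sub_mul_iff_eq_congrSol`,
  `sum_range_ite_dvd_sub_mul`, `congrSol_mod`);
* `jtV D₁ D₂ R S α` — the variance (11.11) `V = ∑_{D₁<d≤D₂} ∑_{a mod d} |∑_{r̄s ≡ a (d)} α_{rs}(r/d')|²`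
  over the box (11.6) `R < r ≤ 2R`, `S < s ≤ 2S` (FI take `D₁ = D`, `D₂ = 2D`; general ranges are
  needed when the level is divided by `e` at the end of the proof); `jtW D₁ D₂ R S γ` — the dual
  form (11.18); `jtNormSq` — `‖γ‖²`; `jtW_eq_sum_congrSol` makes the unique class `a = s r̄`
  explicit;
* `sum_range_e_mul_div_eq` — orthogonality `∑_{k<P} e(kd/P) = P [P ∣ d]` for all integers `d`;
* `injOn_mod_pair`, `sum_range_lcm_mul_mod_le` — `a mod [d₁,d₂] ↦ (a mod d₁, a mod d₂)` is injective
  (used for `σ(γ) ≤ ‖γ‖⁴` in (11.21));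
* **`card_filter_isSquare_ordCompl_mul_le`** — `#{d₂ ≤ N : d₁'d₂' = □} ≤ 4√N` ("`ν(d₁) ≪ √D`" in
  the proof of (11.20)), via squarefree cores (`eq_of_squarefree_of_isSquare_mul`).

## References

* J. Friedlander, H. Iwaniec, Ann. of Math. (2) 148 (1998), 945–1040, §11. [FriedlanderIwaniecAnnals1998]

## Tree / Mathlib

Tree: `LargeSieve.e`, `LargeSieve.sum_range_e_mul_div`, `LargeSieve.e_add_int` (`LargeSieveInequality`,
`LargeSieveCharacters`); `ordCompl_two_mul` (`…JacobiTwistedLemma114`). Mathlib: `ZMod.inv_mul_of_unit`,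
`ZMod.isUnit_iff_coprime`, `ZMod.intCast_zmod_eq_zero_iff_dvd`, `Nat.mod_lcm`,
`Nat.ModEq.eq_of_lt_of_lt`, `Nat.sq_mul_squarefree_of_pos`, `Nat.Squarefree.ext_iff`,
`Nat.pow_dvd_pow_iff`, `geom_sum_Ico_le_of_lt_one`, `Real.nat_sqrt_le_real_sqrt`.
-/

noncomputable section

open Finset Real Complex
open scoped NumberTheorySymbols ArithmeticFunction.sigma Nat

namespace Literature.NumberTheory.Sieve.FriedlanderIwaniecPrimes

open LargeSieve (e)



/-! ### Orthogonality of additive characters modulo `P` -/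

/-- `∑_{k < P} e(kd/P) = P [P ∣ d]` for every integer `d` (the tree's `sum_range_e_mul_div` is the
case `|d| < P`; the same statement is `CubicSieve.sum_range_e_mul_div_eq_ite_dvd` in
`HeathBrownCubicLemma51`, not imported here to keep this unit independent of the cubic-sieve
development). [folklore] -/
theorem sum_range_e_mul_div_eq {P : ℕ} (hP : 0 < P) (d : ℤ) :
    ∑ k ∈ range P, e ((k : ℝ) * d / P) = if (P : ℤ) ∣ d then (P : ℂ) else 0 := by
  have hPz : (0 : ℤ) < P := by exact_mod_cast hP
  -- reduce `d` modulo `P`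
  set d₀ : ℤ := d % P with hd₀
  have hd : d = d₀ + P * (d / P) := by rw [hd₀, Int.emod_add_mul_ediv]
  have hper : ∀ k : ℕ, e ((k : ℝ) * d / P) = e ((k : ℝ) * d₀ / P) := by
    intro k
    have hP' : (P : ℝ) ≠ 0 := by exact_mod_cast hP.ne'
    have : (k : ℝ) * d / P = (k : ℝ) * d₀ / P + ((k * (d / P) : ℤ) : ℝ) := by
      conv_lhs => rw [hd]
      push_cast
      field_simp
    rw [this, LargeSieve.e_add_int]
  rw [sum_congr rfl fun k _ => hper k]
  have hd₀lt : |d₀| < P := by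
    rw [abs_lt]
    exact ⟨by linarith [Int.emod_nonneg d hPz.ne'], Int.emod_lt_of_pos d hPz⟩
  rw [LargeSieve.sum_range_e_mul_div hP hd₀lt]
  have hiff : d₀ = 0 ↔ (P : ℤ) ∣ d := by
    rw [hd₀, Int.dvd_iff_emod_eq_zero]
  simp only [hiff]




/-! ### The class `a = s r̄ (mod m)` -/

/-- For `(r, m) = 1` the unique `a (mod m)` with `s ≡ a r (mod m)`, i.e. `a = s r̄`, as a natural
number `< m` (FI's "`r̄` denotes the multiplicative inverse modulo `d`"). [cite: FriedlanderIwaniecAnnals1998, §11, (11.5)] -/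
def congrSol (m r s : ℕ) : ℕ := ((s : ZMod m) * (r : ZMod m)⁻¹).val

/-- Unfolding `congrSol`. [folklore] -/
theorem congrSol_def (m r s : ℕ) : congrSol m r s = ((s : ZMod m) * (r : ZMod m)⁻¹).val := rfl

/-- `s r̄ mod m < m`. [folklore] -/
theorem congrSol_lt {m : ℕ} (hm : 0 < m) (r s : ℕ) : congrSol m r s < m := by
  haveI : NeZero m := ⟨hm.ne'⟩
  exact ZMod.val_lt _

/-- `s ≡ (s r̄) r (mod m)`. [folklore] -/
theorem dvd_sub_congrSol_mul {m r : ℕ} (hm : 0 < m) (hr : r.Coprime m) (s : ℕ) :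
    (m : ℤ) ∣ (s : ℤ) - (congrSol m r s : ℤ) * r := by
  haveI : NeZero m := ⟨hm.ne'⟩
  have hu : IsUnit (r : ZMod m) := (ZMod.isUnit_iff_coprime r m).mpr hr
  rw [← ZMod.intCast_zmod_eq_zero_iff_dvd]
  push_cast
  rw [congrSol_def, ZMod.natCast_zmod_val, mul_assoc, ZMod.inv_mul_of_unit _ hu, mul_one, sub_self]

/-- Uniqueness: for `a < m`, `s ≡ a r (mod m)` iff `a = s r̄`. [folklore] -/
theorem dvd_sub_mul_iff_eq_congrSol {m r : ℕ} (hm : 0 < m) (hr : r.Coprime m) (s : ℕ) {a : ℕ}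
    (ha : a < m) : (m : ℤ) ∣ (s : ℤ) - (a : ℤ) * r ↔ a = congrSol m r s := by
  haveI : NeZero m := ⟨hm.ne'⟩
  have hu : IsUnit (r : ZMod m) := (ZMod.isUnit_iff_coprime r m).mpr hr
  constructor
  · intro h
    rw [← ZMod.intCast_zmod_eq_zero_iff_dvd] at h
    push_cast at h
    rw [sub_eq_zero] at h
    -- `a = s r⁻¹` in `ZMod m`
    have h2 : (a : ZMod m) = (s : ZMod m) * (r : ZMod m)⁻¹ := by
      rw [h, mul_assoc, ZMod.mul_inv_of_unit _ hu, mul_one]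
    have h3 := congrArg ZMod.val h2
    rwa [ZMod.val_natCast, Nat.mod_eq_of_lt ha] at h3
  · rintro rfl
    exact dvd_sub_congrSol_mul hm hr s

/-- The filtered sum over `a < m` picks out the single class `a = s r̄`. [folklore] -/
theorem sum_range_ite_dvd_sub_mul {M : Type*} [AddCommMonoid M] {m r : ℕ} (hm : 0 < m)
    (hr : r.Coprime m) (s : ℕ) (F : ℕ → M) :
    ∑ a ∈ range m, (if (m : ℤ) ∣ (s : ℤ) - (a : ℤ) * r then F a else 0) = F (congrSol m r s) := by
  rw [← sum_filter]
  have hset : (range m).filter (fun a : ℕ => (m : ℤ) ∣ (s : ℤ) - (a : ℤ) * r) = ({congrSol m r s} : Finset ℕ) := by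
    ext a
    rw [mem_filter, mem_range, mem_singleton]
    constructor
    · rintro ⟨ha, h⟩; exact (dvd_sub_mul_iff_eq_congrSol hm hr s ha).mp h
    · rintro rfl; exact ⟨congrSol_lt hm r s, dvd_sub_congrSol_mul hm hr s⟩
  rw [hset, sum_singleton]

/-- Compatibility with reduction: for `n ∣ m`, `(s r̄ mod m) mod n = s r̄ mod n`. [folklore] -/
theorem congrSol_mod {m n r : ℕ} (hm : 0 < m) (hn : 0 < n) (hnm : n ∣ m) (hr : r.Coprime m)
    (s : ℕ) : congrSol m r s % n = congrSol n r s := by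
  have hrn : r.Coprime n := hr.coprime_dvd_right hnm
  refine (dvd_sub_mul_iff_eq_congrSol hn hrn s (Nat.mod_lt _ hn)).mp ?_
  have h1 := dvd_sub_congrSol_mul hm hr s
  have h2 : (n : ℤ) ∣ (s : ℤ) - (congrSol m r s : ℤ) * r := (Int.natCast_dvd_natCast.mpr hnm).trans h1
  have h3 : (n : ℤ) ∣ ((congrSol m r s : ℤ) - (congrSol m r s % n : ℕ)) * r := by
    refine Dvd.dvd.mul_right ?_ _
    have h5 : n ∣ congrSol m r s - congrSol m r s % n := Nat.dvd_sub_mod _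
    have h4 : ((congrSol m r s : ℤ) - (congrSol m r s % n : ℕ)) =
        ((congrSol m r s - congrSol m r s % n : ℕ) : ℤ) := by
      rw [Nat.cast_sub (Nat.mod_le _ _)]
    rw [h4]
    exact Int.natCast_dvd_natCast.mpr h5
  have := dvd_add h2 h3
  have he : (s : ℤ) - (congrSol m r s : ℤ) * r + ((congrSol m r s : ℤ) - (congrSol m r s % n : ℕ)) * r =
      (s : ℤ) - ((congrSol m r s % n : ℕ) : ℤ) * r := by ring
  rwa [he] at this

/-! ### Residues modulo `[d₁, d₂]` and the pair of residues modulo `d₁`, `d₂` -/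

/-- `a ↦ (a mod d₁, a mod d₂)` is injective on `a < [d₁, d₂]`. [folklore] -/
theorem injOn_mod_pair (d₁ d₂ : ℕ) :
    Set.InjOn (fun a : ℕ => (a % d₁, a % d₂)) ↑(range (Nat.lcm d₁ d₂)) := by
  intro a ha b hb h
  rw [mem_coe, mem_range] at ha hb
  simp only [Prod.mk.injEq] at h
  have e1 : a ≡ b [MOD d₁] := h.1
  have e2 : a ≡ b [MOD d₂] := h.2
  exact Nat.ModEq.eq_of_lt_of_lt (Nat.mod_lcm e1 e2) ha hb

/-- For `u, v ≥ 0`: `∑_{a < [d₁,d₂]} u(a mod d₁) v(a mod d₂) ≤ (∑_{a₁ < d₁} u a₁)(∑_{a₂ < d₂} v a₂)`.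
[folklore] -/
theorem sum_range_lcm_mul_mod_le {d₁ d₂ : ℕ} (h₁ : 0 < d₁) (h₂ : 0 < d₂) {u v : ℕ → ℝ}
    (hu : ∀ a, 0 ≤ u a) (hv : ∀ a, 0 ≤ v a) :
    ∑ a ∈ range (Nat.lcm d₁ d₂), u (a % d₁) * v (a % d₂) ≤
      (∑ a₁ ∈ range d₁, u a₁) * (∑ a₂ ∈ range d₂, v a₂) := by
  rw [sum_mul_sum, ← sum_product']
  calc ∑ a ∈ range (Nat.lcm d₁ d₂), u (a % d₁) * v (a % d₂)
      = ∑ p ∈ (range (Nat.lcm d₁ d₂)).image (fun a => (a % d₁, a % d₂)), u p.1 * v p.2 := by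
        rw [sum_image (injOn_mod_pair d₁ d₂)]
    _ ≤ ∑ p ∈ range d₁ ×ˢ range d₂, u p.1 * v p.2 := by
        refine sum_le_sum_of_subset_of_nonneg ?_ fun _ _ _ => mul_nonneg (hu _) (hv _)
        intro p hp
        rw [mem_image] at hp
        obtain ⟨a, -, rfl⟩ := hp
        exact mem_product.mpr ⟨mem_range.mpr (Nat.mod_lt _ h₁), mem_range.mpr (Nat.mod_lt _ h₂)⟩




/-! ### Counting `d₂` with `d₁' d₂'` a square -/

/-- Two squarefree numbers whose product is a square are equal. [folklore] -/
theorem eq_of_squarefree_of_isSquare_mul {c c₂ : ℕ} (hc : Squarefree c) (hc₂ : Squarefree c₂)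
    (h : IsSquare (c * c₂)) : c = c₂ := by
  obtain ⟨t, ht⟩ := h
  have key : ∀ {x y : ℕ}, Squarefree x → x * y = t * t → ∀ p : ℕ, p.Prime → p ∣ x → p ∣ y := by
    intro x y hx hxy p hp hpx
    by_contra hpy
    have hpt : p ∣ t := by
      have : p ∣ t * t := hxy ▸ hpx.mul_right y
      exact (Nat.Prime.dvd_mul hp).mp this |>.elim id id
    have hpp : p * p ∣ x * y := hxy ▸ Nat.mul_dvd_mul hpt hpt
    have hcop : Nat.Coprime (p * p) y :=
      Nat.Coprime.mul_left ((Nat.Prime.coprime_iff_not_dvd hp).mpr hpy)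
        ((Nat.Prime.coprime_iff_not_dvd hp).mpr hpy)
    have : p * p ∣ x := hcop.dvd_of_dvd_mul_right hpp
    exact hp.not_isUnit (hx p this)
  rw [Nat.Squarefree.ext_iff hc hc₂]
  intro p hp
  exact ⟨key hc ht p hp, key hc₂ (by rw [mul_comm]; exact ht) p hp⟩

/-- If `u² c · (u₂² c₂)` is a square (`u, u₂ ≥ 1`) then so is `c c₂`. [folklore] -/
theorem isSquare_of_isSquare_sq_mul {u c u₂ c₂ : ℕ} (hu : 0 < u) (hu₂ : 0 < u₂)
    (h : IsSquare (u ^ 2 * c * (u₂ ^ 2 * c₂))) : IsSquare (c * c₂) := by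
  obtain ⟨t, ht⟩ := h
  set w := u * u₂ with hw
  have hw0 : 0 < w := Nat.mul_pos hu hu₂
  have hwt : w ^ 2 * (c * c₂) = t ^ 2 := by rw [sq t, ← ht, hw]; ring
  have hdvd : w ∣ t := by
    rw [← Nat.pow_dvd_pow_iff two_ne_zero, ← hwt]
    exact Dvd.intro _ rfl
  obtain ⟨k, rfl⟩ := hdvd
  refine ⟨k, ?_⟩
  have : w ^ 2 * (c * c₂) = w ^ 2 * (k * k) := by rw [hwt]; ring
  exact Nat.eq_of_mul_eq_mul_left (pow_pos hw0 2) this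

/-- `∑_{i < n} (1/√2)^i ≤ 4`. [folklore] -/
theorem sum_inv_sqrt_two_pow_le (n : ℕ) : ∑ i ∈ range n, (Real.sqrt 2)⁻¹ ^ i ≤ 4 := by
  have hs : 0 < Real.sqrt 2 := Real.sqrt_pos.mpr two_pos
  have hs1 : 4 / 3 ≤ Real.sqrt 2 := by
    rw [Real.le_sqrt (by norm_num) (by norm_num)]; norm_num
  have hx0 : 0 ≤ (Real.sqrt 2)⁻¹ := by positivity
  have hx1 : (Real.sqrt 2)⁻¹ ≤ 3 / 4 := by
    rw [inv_le_comm₀ hs (by norm_num)]; linarith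
  have hlt : (Real.sqrt 2)⁻¹ < 1 := by linarith
  have := geom_sum_Ico_le_of_lt_one (m := 0) (n := n) hx0 hlt
  rw [pow_zero] at this
  simp only [range_eq_Ico] at *
  calc ∑ i ∈ Ico 0 n, (Real.sqrt 2)⁻¹ ^ i ≤ 1 / (1 - (Real.sqrt 2)⁻¹) := this
    _ ≤ 4 := by rw [div_le_iff₀ (by linarith)]; linarith

/-- **The number of `d₂ ≤ N` with `d₁' d₂' = □` is `≤ 4 √N`** (`ν(d₁) ≪ √D` in the proof of
(11.20)): with `d₁' = c u²`, `c` squarefree, such `d₂` are exactly the `2^v c k²`, and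
`∑_v √(N/2^v) ≤ √N/(1 − 2^{−1/2})`. [cite: FriedlanderIwaniecAnnals1998, §11, proof of (11.20)] -/
theorem card_filter_isSquare_ordCompl_mul_le {d₁ : ℕ} (hd₁ : 0 < d₁) (N : ℕ) :
    (#((Icc 1 N).filter fun d₂ => IsSquare (ordCompl[2] (d₁ * d₂))) : ℝ) ≤ 4 * Real.sqrt N := by
  have hn₁ : 0 < ordCompl[2] d₁ := Nat.ordCompl_pos 2 hd₁.ne'
  obtain ⟨c, u, hc0, hu0, hcu, hc⟩ := Nat.sq_mul_squarefree_of_pos hn₁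
  -- the structure of a valid `d₂`
  have hstruct : ∀ d₂ ∈ (Icc 1 N).filter (fun d₂ => IsSquare (ordCompl[2] (d₁ * d₂))),
      ordCompl[2] d₂ = c * (Nat.sqrt (ordCompl[2] d₂ / c)) ^ 2 ∧
      1 ≤ Nat.sqrt (ordCompl[2] d₂ / c) ∧ Nat.sqrt (ordCompl[2] d₂ / c) ≤ Nat.sqrt (N / 2 ^ d₂.factorization 2) ∧
      d₂.factorization 2 < Nat.log 2 N + 1 := by
    intro d₂ hd₂
    rw [mem_filter, mem_Icc] at hd₂
    obtain ⟨⟨h1, h2⟩, hsq⟩ := hd₂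
    have hd₂0 : d₂ ≠ 0 := by omega
    have hn₂ : 0 < ordCompl[2] d₂ := Nat.ordCompl_pos 2 hd₂0
    obtain ⟨c₂, u₂, hc₂0, hu₂0, hcu₂, hc₂⟩ := Nat.sq_mul_squarefree_of_pos hn₂
    rw [ordCompl_two_mul, ← hcu, ← hcu₂] at hsq
    have hcc : c = c₂ := eq_of_squarefree_of_isSquare_mul hc hc₂ (isSquare_of_isSquare_sq_mul hu0 hu₂0
      (by simpa [mul_comm, mul_assoc, mul_left_comm] using hsq))
    subst hcc
    have hdiv : ordCompl[2] d₂ / c = u₂ ^ 2 := by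
      rw [← hcu₂, Nat.mul_div_cancel _ hc0]
    have hsqrt : Nat.sqrt (ordCompl[2] d₂ / c) = u₂ := by rw [hdiv, Nat.sqrt_eq']
    rw [hsqrt]
    refine ⟨by rw [← hcu₂, mul_comm], hu₂0, ?_, ?_⟩
    · rw [Nat.le_sqrt, Nat.le_div_iff_mul_le (pow_pos two_pos _)]
      calc u₂ * u₂ * 2 ^ d₂.factorization 2 ≤ ordCompl[2] d₂ * 2 ^ d₂.factorization 2 := by
            refine Nat.mul_le_mul_right _ ?_
            rw [← hcu₂, sq]; exact Nat.le_mul_of_pos_right _ hc0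
        _ = d₂ := by rw [mul_comm]; exact Nat.ordProj_mul_ordCompl_eq_self d₂ 2
        _ ≤ N := h2
    · refine Nat.lt_succ_of_le (Nat.le_log_of_pow_le one_lt_two ?_)
      calc 2 ^ d₂.factorization 2 ≤ 2 ^ d₂.factorization 2 * ordCompl[2] d₂ :=
            Nat.le_mul_of_pos_right _ hn₂
        _ = d₂ := Nat.ordProj_mul_ordCompl_eq_self d₂ 2
        _ ≤ N := h2
  -- the injection into `{(v, k)}`
  have hinj : Set.InjOn (fun d₂ => (⟨d₂.factorization 2, Nat.sqrt (ordCompl[2] d₂ / c)⟩ : Σ _ : ℕ, ℕ))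
      ↑((Icc 1 N).filter fun d₂ => IsSquare (ordCompl[2] (d₁ * d₂))) := by
    intro d₂ hd₂ d₂' hd₂' h
    simp only [Sigma.mk.inj_iff, heq_eq_eq] at h
    obtain ⟨hv, hk⟩ := h
    have s1 := (hstruct d₂ (mem_coe.mp hd₂)).1
    have s2 := (hstruct d₂' (mem_coe.mp hd₂')).1
    rw [← Nat.ordProj_mul_ordCompl_eq_self d₂ 2, ← Nat.ordProj_mul_ordCompl_eq_self d₂' 2, s1, s2, hk, hv]
  calc (#((Icc 1 N).filter fun d₂ => IsSquare (ordCompl[2] (d₁ * d₂))) : ℝ)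
      ≤ #((range (Nat.log 2 N + 1)).sigma fun v => Icc 1 (Nat.sqrt (N / 2 ^ v))) := by
        exact_mod_cast card_le_card_of_injOn _ (fun d₂ hd₂ => by
          have h := hstruct d₂ (mem_coe.mp hd₂)
          rw [mem_coe, mem_sigma, mem_range, mem_Icc]
          exact ⟨h.2.2.2, h.2.1, h.2.2.1⟩) hinj
    _ = ∑ v ∈ range (Nat.log 2 N + 1), (Nat.sqrt (N / 2 ^ v) : ℝ) := by
        rw [card_sigma]; push_cast
        exact sum_congr rfl fun v _ => by rw [Nat.card_Icc, Nat.add_sub_cancel]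
    _ ≤ ∑ v ∈ range (Nat.log 2 N + 1), Real.sqrt N * (Real.sqrt 2)⁻¹ ^ v := by
        refine sum_le_sum fun v _ => ?_
        calc (Nat.sqrt (N / 2 ^ v) : ℝ) ≤ Real.sqrt ((N / 2 ^ v : ℕ) : ℝ) := Real.nat_sqrt_le_real_sqrt
          _ ≤ Real.sqrt ((N : ℝ) / 2 ^ v) := Real.sqrt_le_sqrt (by exact_mod_cast Nat.cast_div_le)
          _ = Real.sqrt N * (Real.sqrt 2)⁻¹ ^ v := by
              have h2v : Real.sqrt ((2 : ℝ) ^ v) = Real.sqrt 2 ^ v := by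
                rw [show ((2 : ℝ) ^ v) = (Real.sqrt 2 ^ v) ^ 2 by
                  rw [← pow_mul, mul_comm, pow_mul, Real.sq_sqrt (by norm_num)],
                  Real.sqrt_sq (by positivity)]
              rw [Real.sqrt_div (Nat.cast_nonneg N), h2v, div_eq_mul_inv, inv_pow]
    _ = Real.sqrt N * ∑ v ∈ range (Nat.log 2 N + 1), (Real.sqrt 2)⁻¹ ^ v := by rw [mul_sum]
    _ ≤ Real.sqrt N * 4 := mul_le_mul_of_nonneg_left (sum_inv_sqrt_two_pow_le _) (Real.sqrt_nonneg _)
    _ = 4 * Real.sqrt N := mul_comm _ _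




/-! ### The bilinear forms `V(D)` and `W(D)` of (11.11) and (11.18) -/

/-- `χ_d(r) = (r / d')`, the Jacobi symbol to the odd part of `d`. [cite: FriedlanderIwaniecAnnals1998, §11, (11.5)] -/
def jtChar (d r : ℕ) : ℤ := J((r : ℤ) | ordCompl[2] d)

/-- Unfolding `jtChar`. [folklore] -/
theorem jtChar_def (d r : ℕ) : jtChar d r = J((r : ℤ) | ordCompl[2] d) := rfl

/-- `|χ_d(r)| ≤ 1`. [folklore] -/
theorem norm_jtChar_le_one (d r : ℕ) : ‖(jtChar d r : ℂ)‖ ≤ 1 := by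
  rw [jtChar_def, Complex.norm_intCast]
  rcases jacobiSym.trichotomy (r : ℤ) (ordCompl[2] d) with h | h | h <;> simp [h]

/-- **FI (11.11), the variance `V(D)`** over the moduli `D₁ < d ≤ D₂` (FI: `D < d ≤ 2D`), for
coefficients `α_{rs}` on the box `R < r ≤ 2R`, `S < s ≤ 2S` (11.6):
`V = ∑_d ∑_{a mod d} |∑_{r̄ s ≡ a (mod d)} α_{rs} (r / d')|²`, the condition `r̄ s ≡ a (mod d)` meaning
`(r, d) = 1` and `s ≡ a r (mod d)`. [cite: FriedlanderIwaniecAnnals1998, §11, (11.5)-(11.7), (11.11)] -/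
def jtV (D₁ D₂ R S : ℕ) (α : ℕ → ℕ → ℂ) : ℝ :=
  ∑ d ∈ Ioc D₁ D₂, ∑ a ∈ range d, ‖∑ r ∈ Ioc R (2 * R), ∑ s ∈ Ioc S (2 * S),
    (if r.Coprime d ∧ (d : ℤ) ∣ (s : ℤ) - (a : ℤ) * r then α r s * (jtChar d r : ℂ) else 0)‖ ^ 2

/-- **FI (11.18), the dual form `W(D)`**:
`W = ∑_r ∑_s |∑_d ∑_{a ≡ r̄ s (mod d)} γ_{ad} (r / d')|²` for any complex `γ_{ad}` (`a mod d`
represented by `0 ≤ a < d`). [cite: FriedlanderIwaniecAnnals1998, §11, (11.18)] -/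
def jtW (D₁ D₂ R S : ℕ) (γ : ℕ → ℕ → ℂ) : ℝ :=
  ∑ r ∈ Ioc R (2 * R), ∑ s ∈ Ioc S (2 * S), ‖∑ d ∈ Ioc D₁ D₂, ∑ a ∈ range d,
    (if r.Coprime d ∧ (d : ℤ) ∣ (s : ℤ) - (a : ℤ) * r then γ d a * (jtChar d r : ℂ) else 0)‖ ^ 2

/-- `‖γ‖² = ∑_d ∑_{a mod d} |γ_{ad}|²` (FI after (11.20)). [cite: FriedlanderIwaniecAnnals1998, §11, after (11.20)] -/
def jtNormSq (D₁ D₂ : ℕ) (γ : ℕ → ℕ → ℂ) : ℝ := ∑ d ∈ Ioc D₁ D₂, ∑ a ∈ range d, ‖γ d a‖ ^ 2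

/-- Unfolding `jtV`. [folklore] -/
theorem jtV_def (D₁ D₂ R S : ℕ) (α : ℕ → ℕ → ℂ) : jtV D₁ D₂ R S α =
    ∑ d ∈ Ioc D₁ D₂, ∑ a ∈ range d, ‖∑ r ∈ Ioc R (2 * R), ∑ s ∈ Ioc S (2 * S),
      (if r.Coprime d ∧ (d : ℤ) ∣ (s : ℤ) - (a : ℤ) * r then α r s * (jtChar d r : ℂ) else 0)‖ ^ 2 :=
  rfl

/-- Unfolding `jtW`. [folklore] -/
theorem jtW_def (D₁ D₂ R S : ℕ) (γ : ℕ → ℕ → ℂ) : jtW D₁ D₂ R S γ =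
    ∑ r ∈ Ioc R (2 * R), ∑ s ∈ Ioc S (2 * S), ‖∑ d ∈ Ioc D₁ D₂, ∑ a ∈ range d,
      (if r.Coprime d ∧ (d : ℤ) ∣ (s : ℤ) - (a : ℤ) * r then γ d a * (jtChar d r : ℂ) else 0)‖ ^ 2 :=
  rfl

/-- Unfolding `jtNormSq`. [folklore] -/
theorem jtNormSq_def (D₁ D₂ : ℕ) (γ : ℕ → ℕ → ℂ) :
    jtNormSq D₁ D₂ γ = ∑ d ∈ Ioc D₁ D₂, ∑ a ∈ range d, ‖γ d a‖ ^ 2 := rfl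

/-- `‖γ‖² ≥ 0`. [folklore] -/
theorem jtNormSq_nonneg (D₁ D₂ : ℕ) (γ : ℕ → ℕ → ℂ) : 0 ≤ jtNormSq D₁ D₂ γ :=
  sum_nonneg fun _ _ => sum_nonneg fun _ _ => by positivity

/-- `W ≥ 0`. [folklore] -/
theorem jtW_nonneg (D₁ D₂ R S : ℕ) (γ : ℕ → ℕ → ℂ) : 0 ≤ jtW D₁ D₂ R S γ :=
  sum_nonneg fun _ _ => sum_nonneg fun _ _ => by positivity

/-- **`W(D)` with the unique class `a = s r̄` made explicit:**
`W = ∑_r ∑_s |∑_{d : (r,d)=1} γ_d(s r̄ mod d) (r / d')|²`. [cite: FriedlanderIwaniecAnnals1998, §11, (11.18)] -/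
theorem jtW_eq_sum_congrSol (D₁ D₂ R S : ℕ) (γ : ℕ → ℕ → ℂ) : jtW D₁ D₂ R S γ =
    ∑ r ∈ Ioc R (2 * R), ∑ s ∈ Ioc S (2 * S),
      ‖∑ d ∈ (Ioc D₁ D₂).filter (fun d => r.Coprime d), γ d (congrSol d r s) * (jtChar d r : ℂ)‖ ^ 2 := by
  rw [jtW_def]
  refine sum_congr rfl fun r _ => sum_congr rfl fun s _ => ?_
  congr 2
  rw [sum_filter]
  refine sum_congr rfl fun d hd => ?_
  have hd0 : 0 < d := by rw [mem_Ioc] at hd; omega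
  by_cases hrd : r.Coprime d
  · rw [if_pos hrd]
    rw [← sum_range_ite_dvd_sub_mul hd0 hrd s (fun a => γ d a * (jtChar d r : ℂ))]
    refine sum_congr rfl fun a _ => ?_
    by_cases hdv : (d : ℤ) ∣ (s : ℤ) - (a : ℤ) * r
    · rw [if_pos ⟨hrd, hdv⟩, if_pos hdv]
    · rw [if_neg (fun h => hdv h.2), if_neg hdv]
  · rw [if_neg hrd]
    exact sum_eq_zero fun a _ => if_neg fun h => hrd h.1


end Literature.NumberTheory.Sieve.FriedlanderIwaniecPrimes
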